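import Summits.QuantumFields.GaugeBoot.WilsonLoopsGenerateInvariants
import HarnessLib

/-!
# The lattice bootstrap on gauge-invariant data is a system about WILSON-LOOP values (gauge-boot, FFT corollary)

HONEST FRAMING (cell `pub-gaugeboot`, page 1 of every file): the venture produces certified bounds
on lattice expectations at stated coupling, gauge group, dimension and torus size; NOT a mass gap,
NOT a continuum limit, NOT a string tension; NOT Yang–Mills-summit-bearing (barriers
`FixedCouplingUltralocality`, `PerturbativeInvisibility`). Structural; no number is certified.

The lane's `GaugeInvariantBootstrap.lean` proved that the Kazakov–Zheng bootstrap on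
GAUGE-INVARIANT DATA (normalisation, loop positivity `0 ≤ ψ(A(a a))`, gauge-averaged loop
equations `IsSDFunctional … (ψ ∘ₗ A)`, `A` the gauge average) is exact in finite volume — with the
unknowns being the values of `ψ` on ALL gauge-invariant polynomial observables. The first
fundamental theorem (`WilsonLoopsGenerateInvariants.lean`) identifies those unknowns with the
(multi-trace) Wilson loops. This module spells out the consequence: the whole constraint system
only reads `ψ` on the Wilson loop algebra `loopAlgebra r 0`, and its unique solution there is the
Wilson expectation.

## Content (`SU(N) ⊆ ρ(G)`, torus, `N ≥ 1`)

* `gaugeAvgL_eq_self_of_mem_loopAlgebra`, ★ `mem_loopAlgebra_iff_exists_gaugeAvgL` — the loop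
  algebra IS the image of the polynomial observables under the gauge average.
* ★★ `comp_gaugeAvgL_eqOn_of_eqOn_loopAlgebra` — two linear functionals agreeing on the Wilson loop
  algebra have the same gauge-averaged values `ψ(A g)` on every polynomial `g`; hence
  ★★ `gaugeInvariantBootstrap_iff_of_eqOn_loopAlgebra` — they satisfy the Kazakov–Zheng constraints
  (normalisation, loop positivity, gauge-averaged loop equations) together: THE BOOTSTRAP IS A SYSTEM
  OF CONSTRAINTS ON WILSON-LOOP DATA.
* ★★★ `eq_wilson_on_loopAlgebra_of_gaugeInvariantBootstrap_suN` — `SU(N)`, any `β`: a solution of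
  the constraints gives every element of the Wilson loop algebra its Wilson expectation (the lane's
  exactness theorem read on loop data); ★★ `…_su2_singleTrace`: for `SU(2)` the single-trace Wilson
  loops at one base point already carry all of it.

References: V. Kazakov, Z. Zheng, arXiv:2203.11360 §2–§5; arXiv:2404.16925 §2.3, §3.1;
P. Anderson, M. Kruczenski, Nucl. Phys. B 921 (2017). Folklore given the FFT.
-/

noncomputable section

namespace Summit.QuantumFields.GaugeBoot

open MeasureTheory
open Literature.MathematicalPhysics.QuantumFieldTheory (Site Edge GaugeConfig LatticeRep gaugeTransform
  IsGaugeInvariant wilsonMeasure wilsonAction)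
open Literature.MathematicalPhysics.QuantumLattice

variable {d L : ℕ} [NeZero L] {G : Type*} [Group G] [TopologicalSpace G] [IsTopologicalGroup G]
  [CompactSpace G] [MeasurableSpace G] [BorelSpace G] [SecondCountableTopology G] {r : LatticeRep G}

/-! ## The loop algebra is the image of the gauge average -/

/-- The gauge average fixes the Wilson loop algebra. -/
theorem gaugeAvgL_eq_self_of_mem_loopAlgebra {f : C(GaugeConfig d L G, ℝ)}
    (hf : f ∈ loopAlgebra (d := d) (L := L) r 0) : gaugeAvgL d L G f = f :=
  gaugeAvgL_of_isGaugeInvariant (loopAlgebra_le r 0 hf).2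

/-- ★ **The Wilson loop algebra is exactly the image of the polynomial observables under the gauge
average.** -/
theorem mem_loopAlgebra_iff_exists_gaugeAvgL (hSU : TensorFFT.ContainsSU r) (hN : 0 < r.N)
    (f : C(GaugeConfig d L G, ℝ)) :
    f ∈ loopAlgebra (d := d) (L := L) r 0 ↔
      ∃ g ∈ polyAlgebra (ι := Edge d L) r, gaugeAvgL d L G g = f :=
  ⟨fun hf => ⟨f, (loopAlgebra_le r 0 hf).1, gaugeAvgL_eq_self_of_mem_loopAlgebra hf⟩,
    fun ⟨_, hg, hgf⟩ => hgf ▸ gaugeAvgL_mem_loopAlgebra hSU hN hg⟩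

/-! ## Functionals agreeing on Wilson loops -/

/-- ★★ **Two linear functionals agreeing on the Wilson loop algebra have the same gauge-averaged
values on every polynomial observable.** -/
theorem comp_gaugeAvgL_eqOn_of_eqOn_loopAlgebra (hSU : TensorFFT.ContainsSU r) (hN : 0 < r.N)
    {ψ₁ ψ₂ : C(GaugeConfig d L G, ℝ) →ₗ[ℝ] ℝ}
    (h : ∀ f ∈ loopAlgebra (d := d) (L := L) r 0, ψ₁ f = ψ₂ f) :
    ∀ g ∈ polyAlgebra (ι := Edge d L) r, (ψ₁ ∘ₗ gaugeAvgL d L G) g = (ψ₂ ∘ₗ gaugeAvgL d L G) g :=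
  fun _ hg => h _ (gaugeAvgL_mem_loopAlgebra hSU hN hg)

/-- … and agree on every gauge-invariant polynomial observable. -/
theorem eqOn_gaugeInvariant_of_eqOn_loopAlgebra (hSU : TensorFFT.ContainsSU r) (hN : 0 < r.N)
    {ψ₁ ψ₂ : C(GaugeConfig d L G, ℝ) →ₗ[ℝ] ℝ}
    (h : ∀ f ∈ loopAlgebra (d := d) (L := L) r 0, ψ₁ f = ψ₂ f)
    {a : C(GaugeConfig d L G, ℝ)} (ha : a ∈ polyAlgebra (ι := Edge d L) r) (hai : IsGaugeInvariant (⇑a)) :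
    ψ₁ a = ψ₂ a :=
  h a (mem_loopAlgebra_of_isGaugeInvariant hSU hN ha hai)

/-- ★★ **THE BOOTSTRAP ON GAUGE-INVARIANT DATA IS A SYSTEM ABOUT WILSON-LOOP VALUES**: two linear
functionals agreeing on the Wilson loop algebra at the base point satisfy the Kazakov–Zheng
constraints — normalisation, loop positivity, gauge-averaged loop equations (for any family of
one-link shifts `k`, local actions `S` and coupling `β`) — together. -/
theorem gaugeInvariantBootstrap_iff_of_eqOn_loopAlgebra (hSU : TensorFFT.ContainsSU r) (hN : 0 < r.N)
    {K : Type*} (k : K → ℝ → G) (S : Edge d L → GaugeConfig d L G → ℝ) (β : ℝ)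
    {ψ₁ ψ₂ : C(GaugeConfig d L G, ℝ) →ₗ[ℝ] ℝ}
    (h : ∀ f ∈ loopAlgebra (d := d) (L := L) r 0, ψ₁ f = ψ₂ f) :
    (ψ₁ 1 = 1 ∧ (∀ a ∈ polyAlgebra (ι := Edge d L) r, 0 ≤ ψ₁ (gaugeAvgL d L G (a * a))) ∧
        IsSDFunctional r k S β (ψ₁ ∘ₗ gaugeAvgL d L G)) ↔
      (ψ₂ 1 = 1 ∧ (∀ a ∈ polyAlgebra (ι := Edge d L) r, 0 ≤ ψ₂ (gaugeAvgL d L G (a * a))) ∧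
        IsSDFunctional r k S β (ψ₂ ∘ₗ gaugeAvgL d L G)) := by
  have h1 : ψ₁ 1 = ψ₂ 1 := h 1 (Subalgebra.one_mem _)
  have hsq : ∀ a ∈ polyAlgebra (ι := Edge d L) r,
      ψ₁ (gaugeAvgL d L G (a * a)) = ψ₂ (gaugeAvgL d L G (a * a)) := fun a ha =>
    comp_gaugeAvgL_eqOn_of_eqOn_loopAlgebra hSU hN h (a * a) ((polyAlgebra (ι := Edge d L) r).mul_mem ha ha)
  rw [h1, isSDFunctional_congr r (comp_gaugeAvgL_eqOn_of_eqOn_loopAlgebra hSU hN h)]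
  refine and_congr_right fun _ => and_congr_left fun _ => ?_
  exact forall₂_congr fun a ha => by rw [hsq a ha]

/-! ## `SU(N)`: the unique solution on Wilson-loop data is the Wilson expectation -/

/-- ★★★ **`SU(N)` on `(ℤ/L)^d`, ANY real `β`: a solution of the bootstrap on gauge-invariant data
gives EVERY element of the Wilson loop algebra — every polynomial in Wilson loops — its Wilson
expectation** (the lane's exactness theorem `eq_wilson_of_gaugeInvariantBootstrap_suN` read on loop
data through the first fundamental theorem). -/
theorem eq_wilson_on_loopAlgebra_of_gaugeInvariantBootstrap_suN (N : ℕ) (β : ℝ)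
    {ψ : C(GaugeConfig d L (Matrix.specialUnitaryGroup (Fin N) ℂ), ℝ) →ₗ[ℝ] ℝ} (h1 : ψ 1 = 1)
    (hpos : ∀ a ∈ polyAlgebra (ι := Edge d L) (fundamentalLatticeRep N),
      0 ≤ ψ (gaugeAvgL d L _ (a * a)))
    (hψ : IsSDFunctional (fundamentalLatticeRep N) (suExp N)
      (fun _ => wilsonAction (fundamentalRep (Fin N))) β (ψ ∘ₗ gaugeAvgL d L _))
    {f : C(GaugeConfig d L (Matrix.specialUnitaryGroup (Fin N) ℂ), ℝ)}
    (hf : f ∈ loopAlgebra (d := d) (L := L) (fundamentalLatticeRep N) 0) :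
    ψ f = ∫ U, f U ∂(wilsonMeasure (fundamentalRep (Fin N)) β) :=
  eq_wilson_of_gaugeInvariantBootstrap_suN N β h1 hpos hψ (loopAlgebra_le _ 0 hf).1 (loopAlgebra_le _ 0 hf).2

/-- ★★ **Two solutions of the `SU(N)` bootstrap on gauge-invariant data coincide on the Wilson loop
algebra and on every gauge-invariant polynomial observable** (`N ≥ 1`). -/
theorem gaugeInvariantBootstrap_unique_suN (N : ℕ) (hN : 0 < N) (β : ℝ)
    {ψ₁ ψ₂ : C(GaugeConfig d L (Matrix.specialUnitaryGroup (Fin N) ℂ), ℝ) →ₗ[ℝ] ℝ}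
    (h₁ : ψ₁ 1 = 1) (h₂ : ψ₂ 1 = 1)
    (hpos₁ : ∀ a ∈ polyAlgebra (ι := Edge d L) (fundamentalLatticeRep N), 0 ≤ ψ₁ (gaugeAvgL d L _ (a * a)))
    (hpos₂ : ∀ a ∈ polyAlgebra (ι := Edge d L) (fundamentalLatticeRep N), 0 ≤ ψ₂ (gaugeAvgL d L _ (a * a)))
    (hψ₁ : IsSDFunctional (fundamentalLatticeRep N) (suExp N)
      (fun _ => wilsonAction (fundamentalRep (Fin N))) β (ψ₁ ∘ₗ gaugeAvgL d L _))
    (hψ₂ : IsSDFunctional (fundamentalLatticeRep N) (suExp N)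
      (fun _ => wilsonAction (fundamentalRep (Fin N))) β (ψ₂ ∘ₗ gaugeAvgL d L _))
    {a : C(GaugeConfig d L (Matrix.specialUnitaryGroup (Fin N) ℂ), ℝ)}
    (ha : a ∈ polyAlgebra (ι := Edge d L) (fundamentalLatticeRep N)) (hai : IsGaugeInvariant (⇑a)) :
    ψ₁ a = ψ₂ a :=
  eqOn_gaugeInvariant_of_eqOn_loopAlgebra (containsSU_suN N) hN
    (fun f hf => by
      rw [eq_wilson_on_loopAlgebra_of_gaugeInvariantBootstrap_suN N β h₁ hpos₁ hψ₁ hf,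
        eq_wilson_on_loopAlgebra_of_gaugeInvariantBootstrap_suN N β h₂ hpos₂ hψ₂ hf]) ha hai

/-- ★★ **`SU(2)`: SINGLE-TRACE WILSON-LOOP DATA CARRY THE WHOLE BOOTSTRAP** — two linear functionals
agreeing on `1` and on the single-trace Wilson loops `Re tr hol_x(w)` at one base point satisfy the
Kazakov–Zheng constraints together (for any shifts, actions, coupling). -/
theorem gaugeInvariantBootstrap_iff_of_eqOn_singleLoops_su2 (x : Site d L) {K : Type*}
    (k : K → ℝ → Matrix.specialUnitaryGroup (Fin 2) ℂ)
    (S : Edge d L → GaugeConfig d L (Matrix.specialUnitaryGroup (Fin 2) ℂ) → ℝ) (β : ℝ)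
    {ψ₁ ψ₂ : C(GaugeConfig d L (Matrix.specialUnitaryGroup (Fin 2) ℂ), ℝ) →ₗ[ℝ] ℝ} (h1 : ψ₁ 1 = ψ₂ 1)
    (hloops : ∀ w : Word d, Word.endpoint x w = x →
      ψ₁ (loopRe (fundamentalLatticeRep 2) x w) = ψ₂ (loopRe (fundamentalLatticeRep 2) x w)) :
    (ψ₁ 1 = 1 ∧ (∀ a ∈ polyAlgebra (ι := Edge d L) (fundamentalLatticeRep 2),
        0 ≤ ψ₁ (gaugeAvgL d L _ (a * a))) ∧
        IsSDFunctional (fundamentalLatticeRep 2) k S β (ψ₁ ∘ₗ gaugeAvgL d L _)) ↔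
      (ψ₂ 1 = 1 ∧ (∀ a ∈ polyAlgebra (ι := Edge d L) (fundamentalLatticeRep 2),
        0 ≤ ψ₂ (gaugeAvgL d L _ (a * a))) ∧
        IsSDFunctional (fundamentalLatticeRep 2) k S β (ψ₂ ∘ₗ gaugeAvgL d L _)) :=
  gaugeInvariantBootstrap_iff_of_eqOn_loopAlgebra (containsSU_suN 2) (by norm_num) k S β fun f hf =>
    eq_of_eqOn_singleLoops_su2 x h1 hloops (loopAlgebra_le _ 0 hf).1 (loopAlgebra_le _ 0 hf).2

end Summit.QuantumFields.GaugeBoot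

end
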